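import Summits.Ventures.HSemireg.WedgeHankelRecurrenceGaussLaguerreLowering

/-!
# Venture HSemireg — **THE ULTRASPHERICAL STRUCTURE RELATION, DIFFERENTIAL EQUATION AND STIELTJES' THEOREM ON THE LEGENDRE ZEROS** from the recurrence alone: for `a ≡ 0`,
# `b_{n+1} = (n+1)(n+2λ) ∕ (4(n+1+λ)(n+λ))` (`λ > 0`): **`(X² − 1) q_{n+1}' = (n+1) X q_{n+1} − β_{n+1} q_n`** with `β_{n+1} = 2(n+1+λ) b_{n+1} = (n+1)(n+2λ)∕(2(n+λ))`, hence
# **`(X² − 1) q_n'' + (2λ+1) X q_n' − n(n+2λ) q_n = 0`**, and at the zeros `−1 < x_0 < ⋯ < x_t < 1` of `C^{(λ)}_{t+1}` (N390) **`Σ_{j ≠ k} 1∕(x_k − x_j) = (2λ+1) x_k ∕ (2(1 − x_k²))`** — for LEGENDRE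
# (`λ = ½`) STIELTJES' 1885 equilibrium `Σ_{j ≠ k} 1∕(x_k − x_j) = x_k∕(1 − x_k²)` of unit charges between two fixed charges `½` at `±1`

HONEST FRAMING. Part of the Lean index of the computation cell `pub-hsemireg` (seat p10 gen 46, Sunday typer «UNIFORM-IN-n»).  Real polynomials, derivatives and finite sums only; no variety, no
cohomology theory, no sheaf, no Ext group and no semiregularity map is constructed here; nothing here says that HC / HC_CM / HC_AV holds; no Literature fact (unproved `Prop`) is declared or used.
Custodian versions as in `WedgeHankelSiegelIdeal` (1/3).
SOURCES (cited).  T. J. Stieltjes, *Sur quelques théorèmes d'algèbre*, C. R. Acad. Sci. 100 (1885) 439–440, and *Sur les polynômes de Jacobi*, ibid. 620–622; G. Szegő, *Orthogonal Polynomials*,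
(4.7.27) (structure relation), (4.2.1) ∕ (4.7.5) (the ultraspherical equation `(1 − x²) y'' − (2λ+1) x y' + n(n+2λ) y = 0`), §6.7 Thm 6.7.1 (Stieltjes' electrostatic interpretation of the Jacobi
zeros); M. E. H. Ismail, *Classical and Quantum Orthogonal Polynomials* (2005), §3.5; F. Marcellán et al., J. Comput. Appl. Math. 207 (2007) 258–272.
PROOF TYPED HERE.  The structure relation by the pair induction `(★)_{n+1}, (★)_{n+2} ⇒ (★)_{n+3}` using the «classical» linear recurrence `2(n+2+λ) b_{n+2} = 1 + 2(n+λ) b_{n+1}` and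
`b_{n+2}(β_{n+1} + 2 b_{n+1}) = b_{n+1} β_{n+2}`; the equation: `(X² − 1) ·` (equation for `q_{n+2}`) `= (X²−1)·∂(★)_{n+2} − β_{n+2}·(★)_{n+1} + K·(rec) + (n+1+2λ) X·(★)_{n+2} − X q_{n+1}·(2(n+1+λ)β_{n+2}
− K) + q_n·(β_{n+2}β_{n+1} − K b_{n+1})` with `K = (n+2)(n+1+2λ)`, then cancel `X² − 1`; Stieltjes' identity via N388 `sum_inv_sub_nodes_eq`.
DEDUP DISCLOSURE (`rg -n -i 'gegenbauer_structure|gegenbauer_differential|legendre_zeros_electro' Summits/Ventures/HSemireg`, 2026-09-03): N390 (zeros in `(−1,1)`), N389 (Laguerre analogue);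
`HodgeRepro2`'s Legendre files concern `legP` on `[−1,1]` (Bonnet, Turán), not the equation ∕ electrostatics.  The 4 names below: 0 hits tree-wide.

WHAT IS IN THE TREE.  N390 `gegenbauer_zeros`; N388 `sum_inv_sub_nodes_eq`; N284 `eval_derivative_prod_X_sub_C_at_node`; Mathlib `derivative_X_sq`, `X_pow_sub_C_ne_zero`.
THIS FILE (namespace `Summit.Ventures.HSemireg.Wedge.HankelOuter` continued; CHAINED on N391 (import only); 0 definitions):
* §1157 **`gegenbauer_structure_relation`**, **`gegenbauer_differential_equation`**, **`gegenbauer_zeros_electrostatic`**, **`legendre_zeros_electrostatic`** (Stieltjes 1885).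
CAVEATS.  `λ > 0`, monic normalisation, recurrence-only.  Nothing Ext-side.  New names only.
-/

open Module Polynomial
open scoped Matrix Polynomial

namespace Summit.Ventures.HSemireg.Wedge.HankelOuter

/-! ## §1157. Gegenbauer: structure relation, differential equation, Stieltjes' theorem -/

/-- **THE ULTRASPHERICAL STRUCTURE RELATION: `(X² − 1) q_{n+1}' = (n+1) X q_{n+1} − ((n+1)(n+2λ)∕(2(n+λ))) q_n`.** [Szegő (4.7.27); this file, §1157] -/
theorem gegenbauer_structure_relation {q : ℕ → ℝ[X]} {a b : ℕ → ℝ} {lam : ℝ} (hq0 : q 0 = 1) (hq1 : q 1 = Polynomial.X - C (a 0))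
    (hrec : ∀ n, q (n + 2) = (Polynomial.X - C (a (n + 1))) * q (n + 1) - C (b (n + 1)) * q n) (ha : ∀ n, a n = 0)
    (hb : ∀ n, b (n + 1) = ((n : ℝ) + 1) * ((n : ℝ) + 2 * lam) / (4 * ((n : ℝ) + 1 + lam) * ((n : ℝ) + lam))) (hlam : 0 < lam) (n : ℕ) :
    (Polynomial.X ^ 2 - 1) * derivative (q (n + 1)) = C ((n : ℝ) + 1) * Polynomial.X * q (n + 1) - C (((n : ℝ) + 1) * ((n : ℝ) + 2 * lam) / (2 * ((n : ℝ) + lam))) * q n := by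
  -- `β_{m+1} = (m+1)(m+2λ)/(2(m+λ)) = 2(m+1+λ) b_{m+1}`
  obtain ⟨β, hβ⟩ : ∃ β : ℕ → ℝ, β = fun (m : ℕ) => 2 * ((m : ℝ) + lam) * b m := ⟨_, rfl⟩
  have hβv : ∀ m : ℕ, β (m + 1) = ((m : ℝ) + 1) * ((m : ℝ) + 2 * lam) / (2 * ((m : ℝ) + lam)) := fun m => by
    have h0 : (0 : ℝ) ≤ m := Nat.cast_nonneg m
    rw [hβ]; simp only [hb]; push_cast; field_simp; ring
  -- the classical recurrence of the couplings and the companion identity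
  have hcl : ∀ m : ℕ, β (m + 2) = β (m + 1) + 1 - 2 * b (m + 1) := fun m => by
    have h0 : (0 : ℝ) ≤ m := Nat.cast_nonneg m
    rw [show m + 2 = (m + 1) + 1 from rfl, hβv (m + 1), hβv m, hb m]; push_cast; field_simp; ring
  have hF : ∀ m : ℕ, b (m + 2) * β (m + 1) - b (m + 1) * β (m + 2) + 2 * b (m + 1) * b (m + 2) = 0 := fun m => by
    rw [hβ]; push_cast; ring
  have hrec' : ∀ m, q (m + 2) = Polynomial.X * q (m + 1) - C (b (m + 1)) * q m := fun m => by rw [hrec m, ha, C_0, sub_zero]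
  have hq1' : q 1 = Polynomial.X := by rw [hq1, ha, C_0, sub_zero]
  have key : ∀ n, (Polynomial.X ^ 2 - 1) * derivative (q (n + 1)) = ((n : ℝ[X]) + 1) * Polynomial.X * q (n + 1) - C (β (n + 1)) * q n ∧
      (Polynomial.X ^ 2 - 1) * derivative (q (n + 2)) = ((n : ℝ[X]) + 2) * Polynomial.X * q (n + 2) - C (β (n + 2)) * q (n + 1) := by
    intro n
    induction n with
    | zero =>
      have hβ1 : β 1 = 1 := by
        rw [show (1 : ℕ) = 0 + 1 from rfl, hβv 0]; push_cast; field_simp; ring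
      have hβ2 : C (β 2) = 2 - 2 * C (b 1) := by
        have h := hcl 0
        rw [zero_add, zero_add, hβ1] at h
        rw [h, map_sub, map_add, map_mul, map_one, map_ofNat]; ring
      have h2 : q 2 = Polynomial.X * Polynomial.X - C (b 1) * 1 := by have h := hrec' 0; rw [zero_add, zero_add, hq1', hq0] at h; exact h
      constructor
      · rw [zero_add, hq1', hq0, hβ1, derivative_X, map_one]; push_cast; ring
      · rw [zero_add, h2, hq1', hβ2]
        simp only [derivative_sub, derivative_mul, derivative_X, derivative_C, mul_one, one_mul, sub_zero]
        push_cast; ring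
    | succ n ih =>
      obtain ⟨ih1, ih2⟩ := ih
      refine ⟨by rw [show n + 1 + 1 = n + 2 from rfl]; push_cast; rw [show (n : ℝ[X]) + 1 + 1 = (n : ℝ[X]) + 2 by ring]; exact ih2, ?_⟩
      rw [show n + 1 + 2 = n + 3 from rfl, show n + 1 + 1 = n + 2 from rfl]
      have h3 : q (n + 3) = Polynomial.X * q (n + 2) - C (b (n + 2)) * q (n + 1) := hrec' (n + 1)
      have h2 : q (n + 2) = Polynomial.X * q (n + 1) - C (b (n + 1)) * q n := hrec' n
      have hd : derivative (q (n + 3)) = q (n + 2) + Polynomial.X * derivative (q (n + 2)) - C (b (n + 2)) * derivative (q (n + 1)) := by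
        rw [h3]; simp only [derivative_sub, derivative_mul, derivative_X, derivative_C, one_mul, zero_mul, zero_add]
      have hcl' : C (β (n + 3)) = C (β (n + 2)) + 1 - 2 * C (b (n + 2)) := by
        rw [show n + 3 = (n + 1) + 2 from rfl, hcl (n + 1), show n + 1 + 1 = n + 2 from rfl, map_sub, map_add, map_mul, map_one, map_ofNat]
      have hF' : C (b (n + 2)) * C (β (n + 1)) - C (b (n + 1)) * C (β (n + 2)) + 2 * C (b (n + 1)) * C (b (n + 2)) = 0 := by
        have := congrArg C (hF n); simpa only [map_sub, map_add, map_mul, map_ofNat, map_zero, show n + 1 + 1 = n + 2 from rfl] using this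
      push_cast
      rw [hd, h3]
      linear_combination Polynomial.X * ih2 - C (b (n + 2)) * ih1 + (q (n + 2)) * hcl' + (C (β (n + 2)) - 2 * C (b (n + 2))) * h2 + (q n) * hF'
  have h := (key n).1
  rw [hβv] at h
  rw [map_add, map_one, map_natCast]
  exact h

/-- **THE ULTRASPHERICAL DIFFERENTIAL EQUATION: `(X² − 1) q_n'' + (2λ + 1) X q_n' − n(n + 2λ) q_n = 0`.** [Szegő (4.2.1) ∕ (4.7.5); this file, §1157] -/
theorem gegenbauer_differential_equation {q : ℕ → ℝ[X]} {a b : ℕ → ℝ} {lam : ℝ} (hq0 : q 0 = 1) (hq1 : q 1 = Polynomial.X - C (a 0))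
    (hrec : ∀ n, q (n + 2) = (Polynomial.X - C (a (n + 1))) * q (n + 1) - C (b (n + 1)) * q n) (ha : ∀ n, a n = 0)
    (hb : ∀ n, b (n + 1) = ((n : ℝ) + 1) * ((n : ℝ) + 2 * lam) / (4 * ((n : ℝ) + 1 + lam) * ((n : ℝ) + lam))) (hlam : 0 < lam) (n : ℕ) :
    (Polynomial.X ^ 2 - 1) * derivative (derivative (q n)) + C (2 * lam + 1) * Polynomial.X * derivative (q n) - C ((n : ℝ) * ((n : ℝ) + 2 * lam)) * q n = 0 := by
  have hS : (Polynomial.X ^ 2 - 1 : ℝ[X]) ≠ 0 := by rw [← C_1]; exact X_pow_sub_C_ne_zero two_pos 1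
  have hq1' : q 1 = Polynomial.X := by rw [hq1, ha, C_0, sub_zero]
  rcases n with _ | n
  · rw [hq0]; simp
  rcases n with _ | n
  · rw [hq1', derivative_X, derivative_one, mul_zero, zero_add]
    simp only [map_add, map_mul, map_one, map_ofNat, map_natCast]
    ring
  · -- degree `n + 2`
    have h0 : (0 : ℝ) ≤ n := Nat.cast_nonneg n
    obtain ⟨β₂, hβ₂⟩ : ∃ r : ℝ, r = ((n : ℝ) + 1 + 1) * ((n : ℝ) + 1 + 2 * lam) / (2 * ((n : ℝ) + 1 + lam)) := ⟨_, rfl⟩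
    obtain ⟨β₁, hβ₁⟩ : ∃ r : ℝ, r = ((n : ℝ) + 1) * ((n : ℝ) + 2 * lam) / (2 * ((n : ℝ) + lam)) := ⟨_, rfl⟩
    have e0 : (Polynomial.X ^ 2 - 1) * derivative (q (n + 2)) = ((n : ℝ[X]) + 2) * Polynomial.X * q (n + 2) - C β₂ * q (n + 1) := by
      have h := gegenbauer_structure_relation hq0 hq1 hrec ha hb hlam (n + 1)
      push_cast at h
      rw [show n + 1 + 1 = n + 2 from rfl, ← hβ₂, map_add, map_add, map_natCast, map_one] at h
      rw [h]; ring
    have e2 : (Polynomial.X ^ 2 - 1) * derivative (q (n + 1)) = ((n : ℝ[X]) + 1) * Polynomial.X * q (n + 1) - C β₁ * q n := by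
      have h := gegenbauer_structure_relation hq0 hq1 hrec ha hb hlam n
      rw [← hβ₁, map_add, map_natCast, map_one] at h
      exact h
    have e3 : q (n + 2) = Polynomial.X * q (n + 1) - C (b (n + 1)) * q n := by rw [hrec n, ha, C_0, sub_zero]
    have e1 : 2 * Polynomial.X * derivative (q (n + 2)) + (Polynomial.X ^ 2 - 1) * derivative (derivative (q (n + 2))) =
        ((n : ℝ[X]) + 2) * (q (n + 2) + Polynomial.X * derivative (q (n + 2))) - C β₂ * derivative (q (n + 1)) := by
      have h := congrArg derivative e0
      simp only [derivative_mul, derivative_sub, derivative_X_sq, derivative_one, derivative_X, derivative_C, derivative_add, derivative_natCast, derivative_ofNat, map_ofNat,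
        zero_mul, zero_add, sub_zero, mul_one] at h
      linear_combination h
    -- the two scalar identities
    have hI : β₂ * β₁ = ((n : ℝ) + 2) * ((n : ℝ) + 1 + 2 * lam) * b (n + 1) := by rw [hβ₂, hβ₁, hb]; field_simp; ring
    have hII : 2 * ((n : ℝ) + 1 + lam) * β₂ = ((n : ℝ) + 2) * ((n : ℝ) + 1 + 2 * lam) := by rw [hβ₂]; field_simp; ring
    have hIC : C β₂ * C β₁ = ((n : ℝ[X]) + 2) * ((n : ℝ[X]) + 1 + 2 * C lam) * C (b (n + 1)) := by
      rw [← map_mul, hI]; simp only [map_mul, map_add, map_natCast, map_one, map_ofNat]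
    have hIIC : 2 * ((n : ℝ[X]) + 1 + C lam) * C β₂ = ((n : ℝ[X]) + 2) * ((n : ℝ[X]) + 1 + 2 * C lam) := by
      have h := congrArg C hII
      simp only [map_mul, map_add, map_natCast, map_one, map_ofNat] at h
      exact h
    simp only [map_add, map_mul, map_one, map_ofNat, map_natCast]
    push_cast
    apply mul_left_cancel₀ hS
    rw [mul_zero]
    linear_combination (Polynomial.X ^ 2 - 1) * e1 - C β₂ * e2 + (((n : ℝ[X]) + 2) * ((n : ℝ[X]) + 1 + 2 * C lam)) * e3 +
      (((n : ℝ[X]) + 1 + 2 * C lam) * Polynomial.X) * e0 - (Polynomial.X * q (n + 1)) * hIIC + (q n) * hIC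

/-- **STIELTJES' EQUILIBRIUM FOR THE ULTRASPHERICAL ZEROS: `Σ_{j ≠ k} 1∕(x_k − x_j) = (2λ + 1) x_k ∕ (2 (1 − x_k²))`** at the zeros `−1 < x_0 < ⋯ < x_t < 1` of `C^{(λ)}_{t+1}` (`λ > 0`). [Stieltjes 1885;
Szegő Thm 6.7.1; this file, §1157] -/
theorem gegenbauer_zeros_electrostatic {q : ℕ → ℝ[X]} {a b : ℕ → ℝ} {lam : ℝ} (hq0 : q 0 = 1) (hq1 : q 1 = Polynomial.X - C (a 0))
    (hrec : ∀ n, q (n + 2) = (Polynomial.X - C (a (n + 1))) * q (n + 1) - C (b (n + 1)) * q n) (ha : ∀ n, a n = 0)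
    (hb : ∀ n, b (n + 1) = ((n : ℝ) + 1) * ((n : ℝ) + 2 * lam) / (4 * ((n : ℝ) + 1 + lam) * ((n : ℝ) + lam))) (hlam : 0 < lam)
    {t : ℕ} {x : Fin (t + 1) → ℝ} (hx : StrictMono x) (hxq : q (t + 1) = ∏ k, (Polynomial.X - C (x k))) (hmem : ∀ k, -1 < x k ∧ x k < 1) (k : Fin (t + 1)) :
    ∑ j ∈ Finset.univ.erase k, (x k - x j)⁻¹ = (2 * lam + 1) * x k / (2 * (1 - x k ^ 2)) := by
  have hinj := hx.injective
  have hode := congrArg (eval (x k)) (gegenbauer_differential_equation hq0 hq1 hrec ha hb hlam (t + 1))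
  rw [hxq] at hode
  have hroot : (∏ j, (Polynomial.X - C (x j))).eval (x k) = 0 := by rw [eval_prod]; exact Finset.prod_eq_zero (Finset.mem_univ k) (by simp)
  rw [eval_sub, eval_add, eval_mul, eval_mul, eval_mul, eval_mul, eval_sub, eval_pow, eval_X, eval_one, eval_C, eval_C, hroot, mul_zero, sub_zero, eval_zero,
    ← sum_inv_sub_nodes_eq hinj k] at hode
  have hder : (derivative (∏ i, (Polynomial.X - C (x i)))).eval (x k) ≠ 0 := by
    rw [eval_derivative_prod_X_sub_C_at_node]
    exact Finset.prod_ne_zero_iff.2 fun j hj => sub_ne_zero.2 fun h => (Finset.mem_erase.1 hj).1 (hinj h).symm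
  have h1 : 0 < 1 - x k ^ 2 := by nlinarith [(hmem k).1, (hmem k).2]
  rw [eq_div_iff (by positivity)]
  apply mul_left_cancel₀ hder
  linear_combination (-1 : ℝ) * hode

/-- **STIELTJES (1885), LEGENDRE CASE: `Σ_{j ≠ k} 1∕(x_k − x_j) = x_k ∕ (1 − x_k²)`** at the zeros of the monic Legendre polynomial `P_{t+1}` (`a ≡ 0`, `b_n = n²∕(4n²−1)`). [Stieltjes 1885; Szegő
Thm 6.7.1; this file, §1157] -/
theorem legendre_zeros_electrostatic {q : ℕ → ℝ[X]} {a b : ℕ → ℝ} (hq0 : q 0 = 1) (hq1 : q 1 = Polynomial.X - C (a 0))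
    (hrec : ∀ n, q (n + 2) = (Polynomial.X - C (a (n + 1))) * q (n + 1) - C (b (n + 1)) * q n) (ha : ∀ n, a n = 0)
    (hb : ∀ n, b (n + 1) = ((n : ℝ) + 1) ^ 2 / (4 * ((n : ℝ) + 1) ^ 2 - 1))
    {t : ℕ} {x : Fin (t + 1) → ℝ} (hx : StrictMono x) (hxq : q (t + 1) = ∏ k, (Polynomial.X - C (x k))) (hmem : ∀ k, -1 < x k ∧ x k < 1) (k : Fin (t + 1)) :
    ∑ j ∈ Finset.univ.erase k, (x k - x j)⁻¹ = x k / (1 - x k ^ 2) := by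
  have hb' : ∀ n : ℕ, b (n + 1) = ((n : ℝ) + 1) * ((n : ℝ) + 2 * (1 / 2)) / (4 * ((n : ℝ) + 1 + 1 / 2) * ((n : ℝ) + 1 / 2)) := fun n => by
    rw [hb]
    have h0 : (0 : ℝ) ≤ n := Nat.cast_nonneg n
    have h1 : 4 * ((n : ℝ) + 1) ^ 2 - 1 ≠ 0 := by nlinarith
    have h2 : 4 * ((n : ℝ) + 1 + 1 / 2) * ((n : ℝ) + 1 / 2) ≠ 0 := by positivity
    rw [div_eq_div_iff h1 h2]; ring
  rw [gegenbauer_zeros_electrostatic hq0 hq1 hrec ha hb' (by norm_num) hx hxq hmem k]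
  have h1 : 1 - x k ^ 2 ≠ 0 := by nlinarith [(hmem k).1, (hmem k).2]
  field_simp
  ring

end Summit.Ventures.HSemireg.Wedge.HankelOuter
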